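import Literature.MathematicalPhysics.QuantumFieldTheory.Balaban1983to89.B16NodeKnitRecord13CoPH
import Literature.MathematicalPhysics.QuantumFieldTheory.Balaban1983to89.B16Improved189ArbitraryRegionFull

/-!
# `Balaban1983to89.B16NodeKnitRecord13CoPHCor3FullBudget` — [Balaban1989LargeFieldII] Cor. 3 ∕ (0.1) AT THE OBJECTS OF RECORD
(Stage 13, core-keyed Co datum `datumOfRecord₁₃CoPH`), levels `k ≥ 1`, WITH THE PRINTED BUDGET: the record junction
`B16NodeKnitRecord13CoPH.uvIneq_at_record₁₃CoPH_of_gas` with its factor leaves `hZ` ∕ `hY` REPLACED by per-component (1.80) ∕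
(1.80)⁺ budget data through `B16Improved189ArbitraryRegionFull.{hZ_full_of_budget_torus, hY_full_of_controlsT_torus}`, constants
`c := fun _ => c₀`, `c₀ = 2(1+β₀)⁻¹p₀(g_k)`

T. Bałaban, *Large field renormalization. II. Localization, exponentiation, and bounds for the 𝐑 operation*, Commun. Math. Phys.
**122** (1989) 355–392 [Balaban1989LargeFieldII] ((0.1) p. 356, (1.72) p. 379, p. 387 ll. 21–27, (1.80) p. 384); [III] =
[Balaban1988Convergent] Cor. 3 (2.49)–(2.50) p. 264.

statement-level bookkeeping of a published proof with citation tags; proofs kernel-checked; nothing here is a claim about the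
Yang–Mills mass gap

CITATION HEADER.  p. 387 [PDF 33] ll. 21–27 (text layer): *"… hence also an improved bound (1.89), with the additional term
−κ₁d_k(X) in the exponential. This implies the inequality (2.50) [III], hence Corollary 3."*

WHY THIS FILE (W-SEAT-START-LIST §1 n13 item 2 ∕ §n24 item 0 `hUV`, levels `k ≥ 1`).  The record junction of the Cor.-3 chain
(`uvIneq_at_record₁₃CoPH_of_gas`, n24-c's module) reads the factor leaves `hZ`, `hY` as HYPOTHESES with free constants `c : Fin 2 → ℝ`;
the tree's suppliers of those leaves from budget data (`B16Cor3FactorLeavesOfBudget`) give HALF the printed constant.  THIS FILE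
plugs the FULL-budget suppliers of `B16Improved189ArbitraryRegionFull` (p585233) into the record junction: `(UV₁₃)` at a level `k`
FROM per-component data — for the components of `Z_k`: lifts to face-connected ℤ⁴ index families, horizons `K ≥ 1`, budgets
with the (1.79)-factor form, (1.80), profiles with `s_{k+1} = d′_{k+1}(S(X))`, `c₀ ≤ 2p₀(g_{j(X)})`; for the domains `Y_i`: lifts,
budgets with the factor form, (1.80)⁺ at `K = 0`, `c₀ ≤ P` — plus the junction's other inputs VERBATIM (the (1.72) representation
`R` of `ρ_k` OF RECORD (`hH`), its χ-dictionary, the site count, the (1.90) gas of every term, the cube count, (2.49) against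
`(1∕g_k²)·A^η_k` of record with its log-term bounds).  Conclusion: `B16.UVIneq ((datumOfRecord₁₃CoPH F N θ h).C P) k V E₋ E₊` at
every `V` with the junction's explicit `E₋`, `E₊`, the entropy term reading `M₁⁻⁴·K₀(64,8)·Σ_{i<2} e^{−c₀}`.

WHAT THIS FILE PROVES (kernel-checked, zero `sorry`, one theorem, no `def`; axioms standard; BY NAME over n24-c's
`uvIneq_at_record₁₃CoPH_of_gas` and p585233's two leaves — nothing re-proved): **`uvIneq_at_record₁₃CoPH_of_fullBudget_of_gas`**.
HONEST SCOPE.  By-name junction, count-neutral; `(UV₁₃)` at `k ≥ 1` is NOT discharged — its analytic content ([V] Thm 1's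
representation of record `hH`, the per-component factor forms and (1.80) data, the gas, (2.49)) stays displayed as hypotheses
exactly as in n24-c's junction; what changes is only that the leaves are read from (1.80)∕(1.80)⁺ budget data with the PRINTED
constant; the k = 0 conjunct is n13-w1's `…N13UV01LevelZeroAtRecord13` (explicit `ρ₀`, disjoint statement); one finite 𝕋⁴ programme
at fixed ε, Bałaban AS PRINTED; R4 closes the conditional finite-𝕋⁴ rung `BalabanLadder.UV` only — nothing continuum ∕ OS ∕ mass gap ∕
Clay.  Seat `pub-ymgap-dag-n13-w2` (g0), N13 [B16] Cor. 3, `--supports stmt-QuantumFields-20542`.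
-/

noncomputable section

open MeasureTheory
open scoped BigOperators

namespace Literature.MathematicalPhysics.QuantumFieldTheory.Balaban1983to89.B16NodeKnitRecord13CoPHCor3FullBudget

open DagBinding T4DatumAssembly T4Continuum Node00 FlowStepRuns
open B16NodeKnitRecord13CoPH (uvIneq_at_record₁₃CoPH_of_gas)
open B14Thm2 (Ineq249)
open B16Cor3Ops (PosOp Repr172)
open TreeLengthTorus (tsys proj)
open B13FamilySum (Ineq126 VolBound)
open B16Eq190Resummation (bracket mayerTerm F191 polys190 LocalOps DepOn)
open B13ScaleTransfer (Pt FaceConnected)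
open TreeLength (treeLen)
open B16SProfile (Sop)
open B13Factor210Literal (fineCubes)
open B16Improved189ArbitraryRegionFull (hZ_full_of_budget_torus hY_full_of_controlsT_torus)

variable (F : T4Family) (N : ℕ) [NeZero N]

variable (θ : Stage13HParams F N) (h : θ.Provisos₁₃CoPH F N) (P : B12.RunParams) (k : ℕ)

/-- **THE COR.-3 CHAIN'S END THEOREM AT THE OBJECTS OF RECORD WITH THE PRINTED BUDGET** — n24-c's
`uvIneq_at_record₁₃CoPH_of_gas` (one run `P`, one level `k`, at `D := (datumOfRecord₁₃CoPH F N θ h).C P`) with `c := fun _ => c₀` and the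
factor leaves SUPPLIED: `hZ` from the per-component (1.79)∕(1.80) data of the components of `Z_k` (`hZ_full_of_budget_torus`: lifts `X₀`,
horizons `K ≥ 1`, budgets `κ` with `𝐓 1 ≤ exp(−κ − P)`, `Controls b k K κ s`, `s_{k+1} = treeLen (Sop q X₀)`, `c₀ ≤ P`; constants with
`b.d = 4`, dictionary `R·q = L·R_{k+1}`, doubled slope clause), `hY` from the per-domain (1.80)⁺ horizon-0 data of the `Y_i`
(`hY_full_of_controlsT_torus`: lifts `SY`, budgets `κY` with the factor form, `Controls b k 0 (κY − κ₁·d) sY`, `c₀ ≤ PY`); EVERY OTHER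
BINDER — the (1.72) representation `R` of `ρ_k` OF RECORD (`hH`), `hχ01`, `h0χ`, the site count, the (1.90) gas, the cube count, (2.49)
with the volume majorant and the log-term bounds — and the conclusion VERBATIM; entropy term `M₁⁻⁴·K₀(64,8)·Σ_i e^{−c₀}`.  CONDITIONAL on
every input; nothing of Bałaban's asserted; count-neutral. [cite: Balaban1989LargeFieldII, (0.1) p.356, (1.72) p.379, p.387 ll.21–27, (1.80) p.384; Balaban1988Convergent, (2.49)–(2.50) p.264] -/
theorem uvIneq_at_record₁₃CoPH_of_fullBudget_of_gas (Nc : ℕ) [NeZero Nc]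
    (R : Repr172 (GaugeField (F.P P.K) k (SU N)) (tsys 4 Nc).Dom)
    {M₁ : ℝ} (hM : M₁ ≠ 0) (hnum : (Fintype.card (Site (F.P P.K) k) : ℝ) = (M₁ * Nc) ^ 4)
    {κ₁ : ℝ} (hκ : B12TreeDecay.kappa₀ (4 * 2 ^ 4) (2 * 4) ≤ κ₁) (hκ₁ : 0 ≤ κ₁) (c₀ : ℝ)
    (hH : R.Holds (densOfRecord₁₃ F N θ.toStage13Params P k))
    (hχ01 : ∀ a V, 0 ≤ R.χ a V ∧ R.χ a V ≤ 1)
    (h0χ : ∀ V, R.χ R.allSmall V = chiβOfRecord₁₃ F N θ.toStage13Params P.K (gOfRecord₁₃ F N θ.toStage13Params P) k V)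
    -- the components of `Z_k`: composite structure and per-component (1.79)/(1.80) data, replacing `hZ`
    (T : R.Adm → (tsys 4 Nc).Dom → PosOp (GaugeField (F.P P.K) k (SU N))) (l : R.Adm → List (tsys 4 Nc).Dom)
    (hnd : ∀ a, (l a).Nodup) (hset : ∀ a, (l a).toFinset = R.Zc a)
    (hTZ : ∀ a Fn V, (R.TZ a).T Fn V = (PosOp.pi (T a) (l a)).T Fn V)
    (b : Step.Budget.Consts) (L : ℝ) {Rk q : ℕ} (hRk : 0 < Rk) (hq : 0 < q)
    (hC : 0 ≤ b.C) (hbM : 0 ≤ b.M) (hRm : ∀ m, 0 ≤ b.R m) (hdim : b.d = 4)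
    (hRq : ((Rk * q : ℕ) : ℝ) = L * b.R (k + 1)) (hL : 0 ≤ L)
    (hslope2 : 2 * (κ₁ * (4 * 2 ^ 4) * L ^ b.d) ≤ b.C * b.M ^ b.d * b.R (k + 1))
    (X₀ : R.Adm → (tsys 4 Nc).Dom → Finset (Pt 4)) (K : R.Adm → (tsys 4 Nc).Dom → ℕ)
    (κ Pp : R.Adm → (tsys 4 Nc).Dom → ℝ) (s : R.Adm → (tsys 4 Nc).Dom → ℕ → ℝ)
    (hdataZ : ∀ a, ∀ X ∈ R.Zc a, (X₀ a X).Nonempty ∧ FaceConnected (X₀ a X) ∧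
      X.1 = (fineCubes Rk (X₀ a X)).image (proj Nc) ∧ 1 ≤ K a X ∧
      (∀ V, (T a X).T 1 V ≤ Real.exp (-(κ a X) - Pp a X)) ∧ Step.Budget.Controls b k (K a X) (κ a X) (s a X) ∧
      (∀ m, 0 ≤ s a X m) ∧ s a X (k + 1) = treeLen (Sop q (X₀ a X)) ∧ c₀ ≤ Pp a X)
    -- the domains `Y_i`: composite structure and per-domain (1.80)⁺ horizon-0 data, replacing `hY`
    (TY : R.Adm → (tsys 4 Nc).Dom → PosOp (GaugeField (F.P P.K) k (SU N))) (lY : R.Adm → List (tsys 4 Nc).Dom)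
    (hndY : ∀ a, (lY a).Nodup) (hsetY : ∀ a, (lY a).toFinset = R.Ys a)
    (hTYs : ∀ a Fn V, (R.TYs a).T Fn V = (PosOp.pi (TY a) (lY a)).T Fn V)
    (SY : R.Adm → (tsys 4 Nc).Dom → Finset (Pt 4)) (κY PY : R.Adm → (tsys 4 Nc).Dom → ℝ)
    (sY : R.Adm → (tsys 4 Nc).Dom → ℕ → ℝ)
    (hdataY : ∀ a, ∀ Y ∈ R.Ys a, (SY a Y).Nonempty ∧ FaceConnected (SY a Y) ∧
      Y.1 = (fineCubes Rk (SY a Y)).image (proj Nc) ∧ (∀ V, (TY a Y).T 1 V ≤ Real.exp (-(κY a Y) - PY a Y)) ∧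
      Step.Budget.Controls b k 0 (κY a Y - κ₁ * treeLen (fineCubes Rk (SY a Y))) (sY a Y) ∧ c₀ ≤ PY a Y)
    -- the (1.90) gas of every admissible term (verbatim)
    {LF DomY Cube Var Sv : Type*} [Fintype LF] [Fintype DomY] [Fintype Cube] [DecidableEq LF] [DecidableEq DomY]
    [DecidableEq Cube] {adjC : Cube → Cube → Prop} [DecidableRel adjC]
    (hrefl : ∀ a, adjC a a) (hsymm : ∀ a b, adjC a b → adjC b a)
    {locX : LF → Finset Cube} {locY : DomY → Finset Cube} {site : Var → Cube} (Yfix : R.Adm → Finset Cube)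
    (houtX : ∀ a j, (locX j \ Yfix a).Nonempty) (houtY : ∀ a Y, (locY Y \ Yfix a).Nonempty)
    (Op : R.Adm → Finset LF → ((Var → Sv) → ℂ) →+ ((Var → Sv) → ℂ))
    (hOps : ∀ a, LocalOps adjC locX (Yfix a) site (Op a))
    (hOpReal : ∀ a (S : Finset LF) (f : (Var → Sv) → ℂ), (∀ ψ, (f ψ).im = 0) → ∀ φ, (Op a S f φ).im = 0)
    (Vt : R.Adm → DomY → (Var → Sv) → ℂ) (hV : ∀ a Y, DepOn (Yfix a) site (Vt a Y) (locY Y))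
    (hVreal : ∀ a Y ψ, (Vt a Y ψ).im = 0) (cfg : GaugeField (F.P P.K) k (SU N) → (Var → Sv))
    {nbr : Cube → Finset Cube} (hnbr : ∀ a b, adjC a b → a ∈ nbr b) {νn : ℝ} (hν : ∀ b, ((nbr b).card : ℝ) ≤ νn)
    {d : R.Adm → Finset Cube → ℝ} {c₁ Rr κ₀ K₀ cv τ : ℝ} (hd : ∀ a X, 0 ≤ d a X) (hc₁ : 0 ≤ c₁) (hK₀ : 0 ≤ K₀)
    (hτ : 0 ≤ τ)
    (h197 : ∀ a V X, ‖F191 adjC locX locY (Yfix a) (mayerTerm (Op a) (Vt a) (cfg V)) X‖ ≤ c₁ * Real.exp (-(Rr * d a X)))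
    (h126 : ∀ a, Ineq126 (polys190 adjC locX locY (Yfix a)) (fun X => X \ Yfix a) (d a) κ₀ K₀)
    (hvol : ∀ a, VolBound (polys190 adjC locX locY (Yfix a)) (fun X => X \ Yfix a) (d a) cv)
    (hrate : κ₀ + τ * cv ≤ Rr) (hsmall : c₁ * Real.exp (τ * cv) * K₀ * νn ≤ τ)
    (hjunction : ∀ a V, R.curly a V = (bracket (Op a) (Vt a) (cfg V)).re)
    {πc : ℝ} (hQ : (Fintype.card Cube : ℝ) ≤ πc * (Fintype.card (Site (F.P P.K) k) : ℝ))
    (logT : GaugeField (F.P P.K) k (SU N) → ℝ) {CA cΓ cL cL' : ℝ} {Γ : ℕ → ℝ} (hCA : 0 ≤ CA)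
    (hΓ : ∑ n ∈ Finset.Icc 1 k, Γ n ≤ cΓ * (Fintype.card (Site (F.P P.K) k) : ℝ))
    (h249 : ∀ V, Ineq249 (R.A' V) (1 / (gOfRecord₁₃ F N θ.toStage13Params P k) ^ 2 * wilsonBGOfRecord F N θ.εbg P k V) (logT V) CA Γ k)
    (hlog : ∀ V, -(cL * (Fintype.card (Site (F.P P.K) k) : ℝ)) ≤ logT V)
    (hlog' : ∀ V, logT V ≤ cL' * (Fintype.card (Site (F.P P.K) k) : ℝ)) :
    ∀ V : GaugeField (F.P P.K) k (SU N),
      B16.UVIneq ((datumOfRecord₁₃CoPH F N θ h).C P) k V (CA * cΓ + cL + πc * (c₁ * Real.exp (τ * cv) * K₀))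
        (CA * cΓ + cL' + πc * (c₁ * Real.exp (τ * cv) * K₀) +
          M₁⁻¹ ^ 4 * B12TreeDecay.K₀ (4 * 2 ^ 4) (2 * 4) * ∑ _i : Fin 2, Real.exp (-c₀)) :=
  uvIneq_at_record₁₃CoPH_of_gas F N θ h P k Nc R hM hnum hκ (fun _ => c₀) hH hχ01 h0χ
    (hZ_full_of_budget_torus R T l hnd hset hTZ b k c₀ κ₁ L hRk hq (by norm_num) hC hbM hRm hdim hRq hκ₁ hL hslope2 X₀ K κ Pp s
      hdataZ)
    (hY_full_of_controlsT_torus R TY lY hndY hsetY hTYs b k c₀ κ₁ hRk hκ₁ SY κY PY sY hdataY)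
    hrefl hsymm Yfix houtX houtY Op hOps hOpReal Vt hV hVreal cfg hnbr hν hd hc₁ hK₀ hτ h197 h126 hvol hrate hsmall hjunction hQ
    logT hCA hΓ h249 hlog hlog'

end Literature.MathematicalPhysics.QuantumFieldTheory.Balaban1983to89.B16NodeKnitRecord13CoPHCor3FullBudget

end
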